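import Summits.AtomisticToContinuum.HydrodynamicLimit.Theorems.AntiMazurCoboundariesCellForecastPressureDecayKinematicAssemblyStatics
import Literature.Analysis.UnboundedOperators.LinearizedBoltzmannPositivityProofs
import HarnessLib

/-!
# S2d′ · kinematic assembly from the cluster tail, piece 5: Gaussian moments and the pair-kernel sum
# (registered sub-goal `stub_kinematicAssemblyOfTail_kernelSum` of stub `stub_kinematicAssemblyOfTail`, crux line
# `enskog-compensator-martingale`, crux `CellForecastPressureDecay`, stmt-AtomisticToContinuum-13915)

Velocity integrability facts for the equal-time Enskog kinematics (`KinematicRates σ`, stub S2d′) under the Maxwellian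
factor `γ^{⊗n}` of the cell law: the fourth moments `(1 + ‖vᵢ‖)⁴`, `(1 + ‖vᵢ − vⱼ‖)⁴` are integrable with
`∫ (1 + ‖vᵢ − vⱼ‖)⁴ ≤ 16 M₄`, `M₄ = ∫ (1 + ‖w‖)⁴ dγ` (`integrable_one_add_norm_pow_stdGaussian`), and the compensator sum
`F(v) ∑_{i≠j} K_w(vᵢ, vⱼ)` of a bounded velocity functional is integrable with `∫ |F ∑_{i≠j} K_w| ≤ 64 b π n² M₄`
(collision frequency `|K_w(v, u)| ≤ 4bπ‖v − u‖`, `abs_pairKernel_le`).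

References: Cercignani–Illner–Pulvirenti 1994, §2.2, §3.1.
-/

noncomputable section

open MeasureTheory ProbabilityTheory Set Filter Topology
open scoped ENNReal BigOperators InnerProductSpace
open Literature.Analysis.FluidPDE Literature.MathematicalPhysics.KineticTheory
open Literature.Analysis.UnboundedOperators (integrable_one_add_norm_pow_stdGaussian)

namespace Summit.AtomisticToContinuum.HydrodynamicLimit.Theorems.EnskogCompensator

/-! ## Gaussian fourth moments of the velocities -/

section Moments

variable (n : ℕ)

/-- `(1 + ‖a − b‖)⁴ ≤ 8 ((1 + ‖a‖)⁴ + (1 + ‖b‖)⁴)`. [folklore] -/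
theorem one_add_norm_sub_pow_four_le (a b : V3) : (1 + ‖a - b‖) ^ 4 ≤ 8 * ((1 + ‖a‖) ^ 4 + (1 + ‖b‖) ^ 4) := by
  have hX : 0 ≤ 1 + ‖a‖ := by positivity
  have hY : 0 ≤ 1 + ‖b‖ := by positivity
  have h1 : 1 + ‖a - b‖ ≤ (1 + ‖a‖) + (1 + ‖b‖) := by linarith [norm_sub_le a b]
  calc (1 + ‖a - b‖) ^ 4 ≤ ((1 + ‖a‖) + (1 + ‖b‖)) ^ 4 := pow_le_pow_left₀ (by positivity) h1 4
    _ ≤ 8 * ((1 + ‖a‖) ^ 4 + (1 + ‖b‖) ^ 4) := by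
        nlinarith [sq_nonneg ((1 + ‖a‖) - (1 + ‖b‖)), sq_nonneg ((1 + ‖a‖) + (1 + ‖b‖)), mul_nonneg hX hY,
          sq_nonneg ((1 + ‖a‖) ^ 2 - (1 + ‖b‖) ^ 2),
          mul_nonneg (mul_nonneg hX hY) (sq_nonneg ((1 + ‖a‖) - (1 + ‖b‖)))]

/-- The fourth moment `(1 + ‖vᵢ‖)⁴` of one velocity is integrable under `γ^{⊗n}`. [folklore] -/
theorem integrable_one_add_norm_eval (i : Fin n) :
    Integrable (fun v : Fin n → V3 => (1 + ‖v i‖) ^ 4) (Measure.pi fun _ : Fin n => stdGaussian V3) := by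
  have hmp := measurePreserving_eval (fun _ : Fin n => stdGaussian V3) i
  have hg : AEStronglyMeasurable (fun w : V3 => (1 + ‖w‖) ^ 4) (stdGaussian V3) := by fun_prop
  exact (hmp.integrable_comp hg).2 (integrable_one_add_norm_pow_stdGaussian 4)

/-- `∫ (1 + ‖vᵢ‖)⁴ dγ^{⊗n} = M₄ := ∫ (1 + ‖w‖)⁴ dγ`. [folklore] -/
theorem integral_one_add_norm_eval (i : Fin n) :
    ∫ v, (1 + ‖v i‖) ^ 4 ∂(Measure.pi fun _ : Fin n => stdGaussian V3) = ∫ w, (1 + ‖w‖) ^ 4 ∂(stdGaussian V3) := by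
  have hmp := measurePreserving_eval (fun _ : Fin n => stdGaussian V3) i
  have h := integral_map (μ := Measure.pi fun _ : Fin n => stdGaussian V3) hmp.measurable.aemeasurable
    (f := fun w : V3 => (1 + ‖w‖) ^ 4) (by fun_prop)
  rw [hmp.map_eq] at h
  exact h.symm

/-- **The pair moment**: `∫ (1 + ‖vᵢ − vⱼ‖)⁴ dγ^{⊗n} ≤ 16 M₄`, and the integrand is integrable. [folklore] -/
theorem integral_one_add_norm_sub_le (i j : Fin n) :
    Integrable (fun v : Fin n → V3 => (1 + ‖v i - v j‖) ^ 4) (Measure.pi fun _ : Fin n => stdGaussian V3) ∧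
    ∫ v, (1 + ‖v i - v j‖) ^ 4 ∂(Measure.pi fun _ : Fin n => stdGaussian V3) ≤
      16 * ∫ w, (1 + ‖w‖) ^ 4 ∂(stdGaussian V3) := by
  have hdom : Integrable (fun v : Fin n → V3 => 8 * ((1 + ‖v i‖) ^ 4 + (1 + ‖v j‖) ^ 4))
      (Measure.pi fun _ : Fin n => stdGaussian V3) :=
    ((integrable_one_add_norm_eval n i).add (integrable_one_add_norm_eval n j)).const_mul 8
  have hm : AEStronglyMeasurable (fun v : Fin n → V3 => (1 + ‖v i - v j‖) ^ 4)
      (Measure.pi fun _ : Fin n => stdGaussian V3) := by fun_prop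
  have hint : Integrable (fun v : Fin n → V3 => (1 + ‖v i - v j‖) ^ 4) (Measure.pi fun _ : Fin n => stdGaussian V3) :=
    hdom.mono' hm (ae_of_all _ fun v => by
      rw [Real.norm_of_nonneg (by positivity)]
      exact one_add_norm_sub_pow_four_le (v i) (v j))
  refine ⟨hint, ?_⟩
  calc ∫ v, (1 + ‖v i - v j‖) ^ 4 ∂(Measure.pi fun _ : Fin n => stdGaussian V3)
      ≤ ∫ v, 8 * ((1 + ‖v i‖) ^ 4 + (1 + ‖v j‖) ^ 4) ∂(Measure.pi fun _ : Fin n => stdGaussian V3) :=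
        integral_mono hint hdom fun v => one_add_norm_sub_pow_four_le (v i) (v j)
    _ = 16 * ∫ w, (1 + ‖w‖) ^ 4 ∂(stdGaussian V3) := by
        rw [integral_const_mul, integral_add (integrable_one_add_norm_eval n i) (integrable_one_add_norm_eval n j),
          integral_one_add_norm_eval, integral_one_add_norm_eval]
        ring

/-- The number of ordered pairs: `∑ᵢ ∑ⱼ [i ≠ j] = n(n − 1)`. [folklore] -/
theorem sum_sum_ite_one : (∑ i : Fin n, ∑ j : Fin n, (if i = j then (0 : ℝ) else 1)) = n * (n - 1) := by
  have h : ∀ i : Fin n, (∑ j : Fin n, (if i = j then (0 : ℝ) else 1)) = n - 1 := by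
    intro i
    have : ∀ j : Fin n, (if i = j then (0 : ℝ) else 1) = 1 - (if i = j then 1 else 0) := fun j => by
      split_ifs <;> simp
    simp only [this, Finset.sum_sub_distrib, Finset.sum_const, Finset.card_univ, Fintype.card_fin, nsmul_eq_mul,
      mul_one, Finset.sum_ite_eq, Finset.mem_univ, if_true]
  simp only [h, Finset.sum_const, Finset.card_univ, Fintype.card_fin, nsmul_eq_mul]

end Moments

/-! ## The pair-kernel sum -/

section KernelSum

variable (n : ℕ)

/-- Pointwise domination of the pair-kernel sum by fourth moments:
`|F(v) ∑_{i≠j} K_w(vᵢ, vⱼ)| ≤ ∑ᵢ ∑ⱼ 32 b π ((1 + ‖vᵢ‖)⁴ + (1 + ‖vⱼ‖)⁴)`. [cite: CIP1994, §2.2] -/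
theorem abs_kernelSum_le {w : V3 → ℝ} {b : ℝ} (hwb : ∀ x, |w x| ≤ b) {F : (Fin n → V3) → ℝ} (hFb : ∀ v, |F v| ≤ 1)
    (v : Fin n → V3) :
    |F v * ∑ i, ∑ j, (if i = j then 0 else pairKernel w (v i) (v j))| ≤
      ∑ i : Fin n, ∑ j : Fin n, 32 * b * Real.pi * ((1 + ‖v i‖) ^ 4 + (1 + ‖v j‖) ^ 4) := by
  have hb : 0 ≤ b := (abs_nonneg _).trans (hwb 0)
  rw [abs_mul]
  calc |F v| * |∑ i, ∑ j, (if i = j then 0 else pairKernel w (v i) (v j))|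
      ≤ 1 * |∑ i, ∑ j, (if i = j then 0 else pairKernel w (v i) (v j))| :=
        mul_le_mul_of_nonneg_right (hFb v) (abs_nonneg _)
    _ ≤ ∑ i, |∑ j, (if i = j then 0 else pairKernel w (v i) (v j))| := by
        rw [one_mul]; exact Finset.abs_sum_le_sum_abs _ _
    _ ≤ ∑ i, ∑ j, |(if i = j then 0 else pairKernel w (v i) (v j))| :=
        Finset.sum_le_sum fun i _ => Finset.abs_sum_le_sum_abs _ _
    _ ≤ ∑ i : Fin n, ∑ j : Fin n, 32 * b * Real.pi * ((1 + ‖v i‖) ^ 4 + (1 + ‖v j‖) ^ 4) :=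
        Finset.sum_le_sum fun i _ => Finset.sum_le_sum fun j _ => by
          have hK := abs_pairKernel_le hwb (v i) (v j)
          have h1 := (pow_le_one_add_pow_four (norm_nonneg (v i - v j))).1
          have h2 := one_add_norm_sub_pow_four_le (v i) (v j)
          have h3 : 0 ≤ 32 * b * Real.pi * ((1 + ‖v i‖) ^ 4 + (1 + ‖v j‖) ^ 4) := by positivity
          by_cases hij : i = j
          · rw [if_pos hij, abs_zero]; exact h3
          · rw [if_neg hij]
            have h4 : ‖v i - v j‖ ≤ 8 * ((1 + ‖v i‖) ^ 4 + (1 + ‖v j‖) ^ 4) := h1.trans h2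
            calc |pairKernel w (v i) (v j)| ≤ 4 * b * (Real.pi * ‖v i - v j‖) := hK
              _ ≤ 4 * b * (Real.pi * (8 * ((1 + ‖v i‖) ^ 4 + (1 + ‖v j‖) ^ 4))) :=
                  mul_le_mul_of_nonneg_left (mul_le_mul_of_nonneg_left h4 Real.pi_pos.le) (by positivity)
              _ = 32 * b * Real.pi * ((1 + ‖v i‖) ^ 4 + (1 + ‖v j‖) ^ 4) := by ring

/-- One summand of the pair-kernel sum is a measurable function of the velocities. [folklore] -/
theorem measurable_kernelTerm {w : V3 → ℝ} (hw : Continuous w) (i j : Fin n) :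
    Measurable fun v : Fin n → V3 => (if i = j then 0 else pairKernel w (v i) (v j)) := by
  have h3 : Measurable fun v : Fin n → V3 => pairKernel w (v i) (v j) :=
    measurable_pairKernel_comp hw (measurable_pi_apply i) (measurable_pi_apply j)
  by_cases hij : i = j
  · simp only [if_pos hij]
    exact measurable_const
  · simp only [if_neg hij]
    exact h3

/-- The pair-kernel sum is a measurable function of the velocities. [folklore] -/
theorem measurable_kernelSum {w : V3 → ℝ} (hw : Continuous w) {F : (Fin n → V3) → ℝ} (hF : Measurable F) :
    Measurable fun v : Fin n → V3 => F v * ∑ i, ∑ j, (if i = j then 0 else pairKernel w (v i) (v j)) :=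
  hF.mul (Finset.measurable_sum _ fun i _ => Finset.measurable_sum _ fun j _ => measurable_kernelTerm n hw i j)

/-- The dominating fourth moments are integrable, with integral `64 b π n² M₄`. [folklore] -/
theorem integral_momentSum (b : ℝ) :
    Integrable (fun v : Fin n → V3 => ∑ i : Fin n, ∑ j : Fin n, 32 * b * Real.pi * ((1 + ‖v i‖) ^ 4 + (1 + ‖v j‖) ^ 4))
      (Measure.pi fun _ : Fin n => stdGaussian V3) ∧
    ∫ v, ∑ i : Fin n, ∑ j : Fin n, 32 * b * Real.pi * ((1 + ‖v i‖) ^ 4 + (1 + ‖v j‖) ^ 4)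
        ∂(Measure.pi fun _ : Fin n => stdGaussian V3) = 64 * b * Real.pi * n ^ 2 * ∫ w, (1 + ‖w‖) ^ 4 ∂(stdGaussian V3) := by
  have hterm : ∀ i j : Fin n, Integrable (fun v : Fin n → V3 => 32 * b * Real.pi * ((1 + ‖v i‖) ^ 4 + (1 + ‖v j‖) ^ 4))
      (Measure.pi fun _ : Fin n => stdGaussian V3) := fun i j =>
    ((integrable_one_add_norm_eval n i).add (integrable_one_add_norm_eval n j)).const_mul _
  refine ⟨integrable_finsetSum _ fun i _ => integrable_finsetSum _ fun j _ => hterm i j, ?_⟩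
  rw [integral_finsetSum _ fun i _ => integrable_finsetSum _ fun j _ => hterm i j]
  have hij : ∀ i j : Fin n, ∫ v, 32 * b * Real.pi * ((1 + ‖v i‖) ^ 4 + (1 + ‖v j‖) ^ 4)
      ∂(Measure.pi fun _ : Fin n => stdGaussian V3) = 32 * b * Real.pi * (2 * ∫ w, (1 + ‖w‖) ^ 4 ∂(stdGaussian V3)) := by
    intro i j
    rw [integral_const_mul, integral_add (integrable_one_add_norm_eval n i) (integrable_one_add_norm_eval n j),
      integral_one_add_norm_eval, integral_one_add_norm_eval, two_mul]
  simp only [integral_finsetSum _ fun j _ => hterm _ j, hij, Finset.sum_const, Finset.card_univ, Fintype.card_fin,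
    nsmul_eq_mul]
  ring

/-- **The pair-kernel sum is integrable under `γ^{⊗n}`** with `∫ |F ∑_{i≠j} K_w(vᵢ, vⱼ)| ≤ 64 b π n² M₄`
(collision frequency `|K_w(v, u)| ≤ 4bπ‖v − u‖` and Gaussian fourth moments). [cite: CIP1994, §2.2] -/
theorem integrable_kernelSum_pi {w : V3 → ℝ} {b : ℝ} (hw : Continuous w) (hwb : ∀ x, |w x| ≤ b)
    {F : (Fin n → V3) → ℝ} (hF : Measurable F) (hFb : ∀ v, |F v| ≤ 1) :
    Integrable (fun v : Fin n → V3 => F v * ∑ i, ∑ j, (if i = j then 0 else pairKernel w (v i) (v j)))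
      (Measure.pi fun _ : Fin n => stdGaussian V3) ∧
    ∫ v, |F v * ∑ i, ∑ j, (if i = j then 0 else pairKernel w (v i) (v j))| ∂(Measure.pi fun _ : Fin n => stdGaussian V3) ≤
      64 * b * Real.pi * n ^ 2 * ∫ w, (1 + ‖w‖) ^ 4 ∂(stdGaussian V3) := by
  obtain ⟨hDi, hDint⟩ := integral_momentSum n b
  have hint : Integrable (fun v : Fin n → V3 => F v * ∑ i, ∑ j, (if i = j then 0 else pairKernel w (v i) (v j)))
      (Measure.pi fun _ : Fin n => stdGaussian V3) :=
    hDi.mono' (measurable_kernelSum n hw hF).aestronglyMeasurable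
      (ae_of_all _ fun v => by rw [Real.norm_eq_abs]; exact abs_kernelSum_le n hwb hFb v)
  refine ⟨hint, ?_⟩
  rw [← hDint]
  exact integral_mono hint.abs hDi (abs_kernelSum_le n hwb hFb)

end KernelSum


/-! ## The registered sub-goal -/

/-- **Registered sub-goal `stub_kinematicAssemblyOfTail_kernelSum`** (piece of stub `stub_kinematicAssemblyOfTail`,
S2d′, of the line `enskog-compensator-martingale`): **the compensator sum is integrable in the velocities.** For a
continuous `|w| ≤ b` and a measurable velocity functional `|F| ≤ 1`, the sum `F(v) ∑_{i≠j} K_w(vᵢ, vⱼ)` over ordered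
pairs of the Enskog–Boltzmann pair kernel is integrable under `γ^{⊗n}` (i.i.d. standard Maxwellian velocities) with
`∫ |F ∑_{i≠j} K_w(vᵢ, vⱼ)| dγ^{⊗n} ≤ 64 b π n² ∫ (1 + ‖w‖)⁴ dγ`. [cite: CIP1994, §2.2] -/
theorem stub_kinematicAssemblyOfTail_kernelSum : ∀ (n : ℕ) (b : ℝ) (w : V3 → ℝ) (F : (Fin n → V3) → ℝ),
    Continuous w → (∀ x, |w x| ≤ b) → Measurable F → (∀ v, |F v| ≤ 1) →
      Integrable (fun v : Fin n → V3 => F v * ∑ i, ∑ j, (if i = j then 0 else pairKernel w (v i) (v j)))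
        (Measure.pi fun _ : Fin n => stdGaussian V3) ∧
      ∫ v, |F v * ∑ i, ∑ j, (if i = j then 0 else pairKernel w (v i) (v j))| ∂(Measure.pi fun _ : Fin n => stdGaussian V3) ≤
        64 * b * Real.pi * n ^ 2 * ∫ w, (1 + ‖w‖) ^ 4 ∂(stdGaussian V3) :=
  fun n _ _ _ hw hwb hF hFb => integrable_kernelSum_pi n hw hwb hF hFb

end Summit.AtomisticToContinuum.HydrodynamicLimit.Theorems.EnskogCompensator

end
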